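import Mathlib
import Literature.RingTheory.TwoVariableSeries.Basic
import Literature.AlgebraicGeometry.Resolution.CobordantChartCoefficients
import Literature.AlgebraicGeometry.Resolution.CobordantChartPlaneSlice
import Literature.AlgebraicGeometry.Resolution.CobordantTupleGame
import Summits.ResolutionOfSingularities.ResolutionOfSingularities.Theorems.WeightedInvariantLocalWeightedDropMultiplicityLift
import Summits.ResolutionOfSingularities.ResolutionOfSingularities.Theorems.WeightedInvariantLocalWeightedDropMonicDescentDefs

/-!
# `WeightedInvariant.LocalWeightedDrop`, sub-stub N4″: the point-move slices of the descent game as two-variable substitutions (piece T-6′, part A)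

Crux item stmt-ResolutionOfSingularities-8899 `LocalWeightedDrop` (route `ResolutionOfSingularities/WeightedInvariant`), door
`WeightedConstruction` stmt-ResolutionOfSingularities-0571.  [OURS · L1 W4.3, chain w43, lead prover; part A of piece T-6′ (`monicDescentBridge`) of
`N4PRIME-PLAN.md` §11.]

The `PointClause` of the descent game (`…MonicDescentDefs`) presents the slice at the exceptional point `c = (c₀, c₁)` in the chart `y_{i₀} = 0` as
`S = z² + A^S₁ z + A^S₀` with `A^S_j := TupleGame.slice i₀ (s · Bv_j)` where `B_j(s(c+y)) = s^{3−j} Bv_j`.  Here: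
* `pointSliceFamily i₀ c` — the composite two-variable substitution `x_i ↦ s·(c_i + [i ≠ i₀] y)`;
* `slicePointChart_eq` — `slice i₀ ∘ (chart (1,1) c) = subst (pointSliceFamily i₀ c)` on `k[[x₀,x₁]]`;
* `sliceLabel_spec` — `s^{2−j} · A^S_j = B_j ∘ pointSliceFamily`;
* `clauseSum_eq_pos` — the clause's germ is literally `pos A^S₀ A^S₁`.
-/

set_option linter.dupNamespace false -- mandated namespace of this single-conjunct summit

noncomputable section

namespace Summit.ResolutionOfSingularities.ResolutionOfSingularities.Theorems

namespace MonicDescent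

open MvPowerSeries Literature.AlgebraicGeometry.Resolution

variable {k : Type} [Field k]

/-- The composite substitution "chart at `c`, then slice `y_{i₀} = 0`": `x_i ↦ s·(c_i + [i ≠ i₀]·y)` in `k[[s, y]]`. -/
def pointSliceFamily (i₀ : Fin 2) (c : Fin 2 → k) : Fin 2 → MvPowerSeries (Fin 2) k :=
  fun i => X 0 * (C (c i) + if i = i₀ then 0 else X 1)

/-- The composite substitution has zero constant terms. -/
theorem hasSubst_pointSliceFamily (i₀ : Fin 2) (c : Fin 2 → k) : HasSubst (pointSliceFamily i₀ c) :=
  hasSubst_of_constantCoeff_zero fun i => by simp [pointSliceFamily, constantCoeff_X]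

/-- The point chart `(1,1)` at `c` is substitutable. -/
theorem hasSubst_pointChart (c : Fin 2 → k) : HasSubst (CobordantChart.chart (fun _ : Fin 2 => 1) c) :=
  CobordantChart.hasSubst_chart _ _ fun _ hi => absurd hi one_ne_zero

/-- SLICE ∘ CHART = the two-variable substitution. -/
theorem slicePointChart_eq (i₀ : Fin 2) (c : Fin 2 → k) (F : MvPowerSeries (Fin 2) k) :
    TupleGame.slice i₀ (subst (CobordantChart.chart (fun _ : Fin 2 => 1) c) F) = subst (pointSliceFamily i₀ c) F := by
  have hsl := CobordantChartPlaneSlice.hasSubst_slice (R := k) i₀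
  unfold TupleGame.slice
  rw [subst_comp_subst_apply (hasSubst_pointChart c) hsl]
  congr 1
  funext i
  rw [CobordantChart.chart_apply, pow_one, ← coe_substAlgHom hsl, map_mul, map_add]
  simp only [coe_substAlgHom, subst_C, subst_X hsl, if_neg (Fin.succ_ne_zero _).symm, Fin.predAbove_right_zero]
  unfold pointSliceFamily
  congr 2
  by_cases hi : i = i₀
  · rw [if_pos (by rw [hi]), if_pos hi]
  · rw [if_neg (fun h => hi (Fin.succ_injective _ h)), if_neg hi]
    congr 1
    -- the surviving variable is renamed to `X 1`
    have : i₀ = 0 ∨ i₀ = 1 := by fin_cases i₀ <;> simp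
    have hi' : i = 0 ∨ i = 1 := by fin_cases i <;> simp
    rcases this with rfl | rfl <;> rcases hi' with rfl | rfl <;> first | exact absurd rfl hi | decide

/-- The slice fixes `s`-powers (restated for products `s · G`). -/
theorem slice_X_zero_mul (i₀ : Fin 2) (G : MvPowerSeries (Fin 3) k) :
    TupleGame.slice i₀ (X 0 * G) = X 0 * TupleGame.slice i₀ G := by
  have := MultiplicityLift.slice_X_zero_pow_mul (k := k) i₀ 1 G
  rwa [pow_one, pow_one] at this

/-- THE SLICE LABEL: if `B_j ∘ chart = s^{2−j+1} · Bv_j` then `s^{2−j} · slice i₀ (s·Bv_j) = B_j ∘ pointSliceFamily`. -/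
theorem sliceLabel_spec (i₀ : Fin 2) (c : Fin 2 → k) {Bj : MvPowerSeries (Fin 2) k} {Bvj : MvPowerSeries (Fin 3) k} {j : ℕ}
    (h : subst (CobordantChart.chart (fun _ : Fin 2 => 1) c) Bj = X 0 ^ (2 - j + 1) * Bvj) :
    X 0 ^ (2 - j) * TupleGame.slice i₀ (X 0 * Bvj) = subst (pointSliceFamily i₀ c) Bj := by
  rw [← slicePointChart_eq, h, MultiplicityLift.slice_X_zero_pow_mul, slice_X_zero_mul, pow_succ]
  ring

/-- THE CLAUSE GERM IS `pos`: `z² + Σ_j rename(A_j) z^j = pos A₀ A₁`. -/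
theorem clauseSum_eq_pos (T : Fin 2 → MvPowerSeries (Fin 2) k) :
    X (Fin.last 2) ^ 2 + ∑ j : Fin 2, rename (Fin.succAboveEmb (Fin.last 2)) (T j) * X (Fin.last 2) ^ (j : ℕ) =
      pos (T 0) (T 1) := by
  unfold pos
  rw [Fin.sum_univ_two]
  simp

end MonicDescent

end Summit.ResolutionOfSingularities.ResolutionOfSingularities.Theorems

end
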